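import Literature.IUT.HodgeArakelov.EtaleThetaDataOfSettingGaloisUnits
import Literature.IUT.HodgeArakelov.EtaleThetaDataOfSettingCyclotomeTower
import Literature.IUT.HodgeArakelov.IotaInvariantThetaInftyDivisible

/-!
# The change of coefficient cyclotome `Ẑ(1) = Λ(ℚ̄_pˣ) ⥲ l·Δ_Θ` at the model `Π = Π^tp_X̲̲`, CONSTRUCTED from
# abc-iut-L2's cyclotome tower; the Kummer maps of [IUTchII] Cor. 1.12 (c) / Prop. 3.1 (ii) modulo that tower

abc-iut cell, D-0067 wave 4 (seat abc-iut-w4-d007 gen 3; layer L6; GAP-LEDGER row **G-w4d019-1**, its residual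
"modulo the datum `Δ_Θ ≅ Ẑ(1)`"; SUBDAG-IUTchII-Cor-112 rows Cor-112.0.r1 / r3 / r7).  PROOF-ONLY: no definition,
no structure, no instance, no named fact.

S. Mochizuki, *Inter-universal Teichmüller theory II*, kurims manuscript (Dec. 2020), Cor. 1.12 (c) p. 56
(ll. 25–29): "we recall that it follows from the definitions […] that one has a natural inclusion
`M^×_TM(Π) ↪ lim_J H¹(J, (l·Δ_Θ)(Π))`, hence a natural inclusion of `M^×_TM(Π)` into the inductive limit of
the first line"; Prop. 3.1 (ii) p. 88: "`Ψ_cns(M^Θ_*) := M_TM(M^Θ_*) ⊆ lim_J H¹(Π_Ÿ(M^Θ_*)|_J, Π_μ(M^Θ_*))` [where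
J is as in (i)] … equipped with a natural conjugation action by `Π_X(M^Θ_*)`" [cite: Mochizuki2012, Cor 1.12 p.56].
S. Mochizuki, *The étale theta function …*, Publ. RIMS **45** (2009), §1 p. 238 "`(Ẑ(1) ≅) Δ_Θ`"; Cor. 2.19 (ii)
p. 290 (the projective system over a cofinal chain `E ∋ 1`) [cite: MochizukiEtTh2009, Cor 2.19 (ii) p.64].

STATE BEFORE THIS FILE.  The generic Kummer map into abc-iut-L6-t1's genuine limit `lim_K H¹(H ⊓ K, A')`
(`CohomologyLimitKummer.lean`, p416543) and its instantiation at the model `Π := Pi C = Π^tp_X̲̲`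
(`EtaleThetaDataOfSettingGaloisUnits.lean`, p418848: `h1LimKummer_injective_of_coeff`,
`map_h1LimKummer_PiYdd_stable`, …) take ONE datum: a bijective change of coefficient cyclotome
`c : CyclotomeCoefficients (phi C) (l·Δ_Θ) ℚ̄_pˣ`, i.e. a continuous `Π^tp_X̲̲`-equivariant isomorphism
`Λ(ℚ̄_pˣ) = Ẑ(1) ⥲ l·Δ_Θ` — "the" cyclotomic rigidity isomorphism of [IUTchII] Cor. 1.11 (a),(b) p. 49 at the
model, left there as a binder (FACT-LIST F-0658 `DeltaThetaIsoTate` class).  Independently, abc-iut-w4-d041 showed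
(`EtaleThetaDataOfSettingCyclotomeTower.lean`, p419525) that abc-iut-L2-t8's TYPED level data
`τ : D.CyclotomeTower l Es` — "the natural isomorphism `μ_M ≅ (l·Δ_Θ) ⊗ ℤ/Mℤ`" at every level of a cofinal chain,
compatible with the power maps ([EtTh] Def. 2.13 / Cor. 2.19 (ii); `CyclotomeTowerAllLevels.lean` extends it to
all `M ∈ ℕ≥1`: `τ.modAll`, `τ.red_modAll`) — is the SAME datum seen level-wise, and discharged the «no cyclotome
invariants» binder `hfix` from it.

THIS FILE closes the circle: from `τ`, the origin guard `hO : D.IsEtThOrigin` ("`Δ_X` profinite free on 2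
generators", whence `⋂_M (l·Δ_Θ)^M = 1`, abc-iut-w4-d041's `lDeltaTheta_eq_one_of_forall_exists_pow_eq`) and the
STRUCTURAL topological input `hΔ : IsCompact Δ_Θ` ([EtTh] p. 238 "abelian profinite groups `1 → Δ_Θ → (Δ^tp_Y)^Θ → …`";
the binder already used by abc-iut-w5-d187's `IotaInvariantThetaInftyDivisible.lean` — the interface `ThetaSetting`
leaves the topology of `(Π^tp_X)^Θ` unconstrained), it PROVES
* `exists_cyclotomeCoefficients_of_cyclotomeTower` — **there is a bijective change of coefficient cyclotome
  `c : Λ(ℚ̄_pˣ) ⥲ l·Δ_Θ` (continuous, `Π^tp_X̲̲`-equivariant) whose inverse is `t ↦ ((l·Δ_Θ ↠ μ_M)(t))_M`**, i.e.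
  `(τ.modAll M).red (c ζ) = ζ_M` for all `M`: level-wise `t ↦ (red_M t)_M` lands in the cyclotome (compatibility
  `red_modAll`), is injective (`⋂_M (l·Δ_Θ)^M = 1`), surjective (Cantor intersection in the compact `l·Δ_Θ`:
  the fibres over a compatible family are nonempty closed and directed [cite: RibesZalesskii2010, Thm 2.7.1]),
  continuous, hence a homeomorphism onto the Hausdorff `Λ(ℚ̄_pˣ)`; equivariance is `red_conj`;
* `eq_of_forall_modAll_red_eq` — canonicity: an element of `l·Δ_Θ` is determined by its reductions;
and then, WITHOUT any coefficient binder (conclusions do not mention `c`):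
* `h1LimRestrict_PiYdd_injective_of_cyclotomeTower` — Cor. 1.12 (c)'s second inclusion
  `lim_J H¹(J, l·Δ_Θ) ↪ lim_J H¹(Π^tp_Ÿ̲̲ ⊓ J, l·Δ_Θ)` (abc-iut-L6-t1's interface field
  `ThetaEvaluation.inclHd_injective`) from `hO`, `τ` only (abc-iut-w4-d041's `hfix` route; no `hΔ`);
* `exists_h1LimKummer_top_of_cyclotomeTower` — Cor. 1.12 (c)'s first inclusion: an injective
  `Π^tp_X̲̲`-equivariant Kummer map `ℚ̄_pˣ (⊇ M^×_TM) → lim_K H¹(K, l·Δ_Θ)`;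
* `exists_h1LimKummer_PiYdd_of_cyclotomeTower` — Prop. 3.1 (ii): an injective `Π^tp_X̲̲`-equivariant Kummer
  map `ℚ̄_pˣ (⊇ O^▷) → lim_K H¹(Π^tp_Ÿ̲̲ ⊓ K, l·Δ_Θ)` under which the image of every Galois-stable submonoid
  (the constants `𝒪^▷`, the units `𝒪^×`) is stable under the conjugation action.
So G-w4d019-1 is closed modulo the TYPED [EtTh] datum `CyclotomeTower` (+ `IsEtThOrigin`, `IsCompact Δ_Θ`),
the same inputs as the rest of the [IUTchII] §1–§2 model files; no `def … : Prop` hypothesis remains in this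
corner.  Claim key of the [IUTchII] interface `Mochizuki2012` (D-0012, DISPUTED); [EtTh] is refereed; the
mathematics here is profinite group theory and Kummer theory over landed files.  Nothing in this file bears on
[IUTchIII] Cor. 3.12; typed/instantiated ≠ proved.
-/

noncomputable section

namespace Literature.IUT.HodgeArakelov

namespace EtaleThetaDataOfSetting

open Literature.AnabelianGeometry.EtaleTheta Literature.AnabelianGeometry.SemiGraphs

variable {p : ℕ} [Fact p.Prime] {D : Literature.AnabelianGeometry.EtaleTheta.ThetaSetting p}
  {E : D.EtaleThetaData} {l : ℕ} (C : E.DoubleUnderline l) {Es : Set ℕ+}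

/-! ### Level-wise facts about the tower `(l·Δ_Θ ↠ μ_M)_M` -/

/-- The reductions of an element of `l·Δ_Θ` form an element of the cyclotome `Λ(ℚ̄_pˣ) = lim_M μ_M(ℚ̄_p)`:
`(red_M t)^M = 1` and `(red_{MN} t)^N = red_M t` (`red_modAll`). [cite: MochizukiEtTh2009, Cor 2.19 (ii) p.64] -/
theorem modAll_red_mem_cyclotome (τ : D.CyclotomeTower l Es) (t : D.lDeltaTheta l) :
    (fun M : ℕ+ => (((τ.modAll M).red t : MuN p M) : (PadicAlgCl p)ˣ)) ∈ cyclotome (PadicAlgCl p)ˣ := by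
  refine ⟨fun M => ?_, fun M N => ?_⟩
  · exact (mem_rootsOfUnity (M : ℕ) _).1 ((τ.modAll M).red t).2
  · have hdvd : ((M : ℕ+) : ℕ) ∣ ((M * N : ℕ+) : ℕ) := by
      rw [PNat.mul_coe]; exact dvd_mul_right _ _
    have h := congrArg (fun z : MuN p M => (z : (PadicAlgCl p)ˣ)) (τ.red_modAll M (M * N) hdvd t)
    simp only [MuN.coe_red] at h
    have hq : ((M * N : ℕ+) : ℕ) / (M : ℕ) = (N : ℕ) := by
      rw [PNat.mul_coe, Nat.mul_div_cancel_left _ M.pos]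
    rw [hq] at h
    exact h

/-- A member `ζ` of the cyclotome reduces compatibly: `(ζ_{M'})^{M'/M} = ζ_M` for `M ∣ M'`, i.e.
`MuN.red (ζ_{M'}) = ζ_M`. [cite: LANA2026Report, §6.1 p.31] -/
theorem red_cyclotome_apply (ζ : cyclotome (PadicAlgCl p)ˣ) (M M' : ℕ+) (h : (M : ℕ) ∣ (M' : ℕ)) :
    MuN.red p M M' h ⟨(ζ : ℕ+ → (PadicAlgCl p)ˣ) M', (mem_rootsOfUnity _ _).2 (ζ.2.1 M')⟩ =
      ⟨(ζ : ℕ+ → (PadicAlgCl p)ˣ) M, (mem_rootsOfUnity _ _).2 (ζ.2.1 M)⟩ := by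
  obtain ⟨k, hk⟩ := h
  have hkpos : 0 < k := Nat.pos_of_ne_zero (by rintro rfl; simp at hk)
  have hM' : M' = M * ⟨k, hkpos⟩ := PNat.coe_injective (by rw [PNat.mul_coe]; exact hk)
  subst hM'
  apply Subtype.ext
  rw [MuN.coe_red]
  change (ζ : ℕ+ → (PadicAlgCl p)ˣ) (M * ⟨k, hkpos⟩) ^ (((M * ⟨k, hkpos⟩ : ℕ+) : ℕ) / (M : ℕ)) = _
  rw [PNat.mul_coe, Nat.mul_div_cancel_left _ M.pos]
  exact ζ.2.2 M ⟨k, hkpos⟩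

/-- **Canonicity / joint injectivity of the tower**: under the origin guard, an element of `l·Δ_Θ` is
determined by its reductions `red_M`, `M ≥ 1` (kernel of `red_M` = `M`-th powers, and `⋂_M (l·Δ_Θ)^M = 1`,
abc-iut-w4-d041's `lDeltaTheta_eq_one_of_forall_exists_pow_eq`). [cite: MochizukiEtTh2009, §1 p.238] -/
theorem eq_of_forall_modAll_red_eq (hO : D.IsEtThOrigin) (τ : D.CyclotomeTower l Es) {s t : D.lDeltaTheta l}
    (h : ∀ M : ℕ+, (τ.modAll M).red s = (τ.modAll M).red t) : s = t := by
  rw [← mul_inv_eq_one]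
  refine D.lDeltaTheta_eq_one_of_forall_exists_pow_eq hO (s * t⁻¹) fun M => ?_
  have h1 : (τ.modAll M).red (s * t⁻¹) = 1 := by rw [map_mul, map_inv, h M, mul_inv_cancel]
  exact ((τ.modAll M).red_ker _).1 h1

/-- **Completeness of the compact `l·Δ_Θ` along the tower** (Cantor intersection): if `Δ_Θ` is compact, every
member `ζ` of the cyclotome is the family of reductions of some `t ∈ l·Δ_Θ` — the fibres `{t | red_M t = ζ_M}`
are nonempty (each `red_M` is onto), closed (`red_M` continuous, `μ_M` discrete) and directed (compatibility),
so they meet. [cite: RibesZalesskii2010, Thm 2.7.1] -/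
theorem exists_forall_modAll_red_eq (hΔ : IsCompact (D.DeltaTheta : Set D.GtpTheta))
    (τ : D.CyclotomeTower l Es) (ζ : cyclotome (PadicAlgCl p)ˣ) :
    ∃ t : D.lDeltaTheta l, ∀ M : ℕ+,
      (τ.modAll M).red t = ⟨(ζ : ℕ+ → (PadicAlgCl p)ˣ) M, (mem_rootsOfUnity _ _).2 (ζ.2.1 M)⟩ := by
  haveI := compactSpace_lDeltaTheta (l := l) hΔ
  let ζM : ∀ M : ℕ+, MuN p M := fun M => ⟨(ζ : ℕ+ → (PadicAlgCl p)ˣ) M, (mem_rootsOfUnity _ _).2 (ζ.2.1 M)⟩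
  let F : ℕ+ → Set (D.lDeltaTheta l) := fun M => {t | (τ.modAll M).red t = ζM M}
  have hsub : ∀ (M M' : ℕ+) (h : (M : ℕ) ∣ (M' : ℕ)), F M' ⊆ F M := by
    intro M M' h t ht
    have ht' : (τ.modAll M').red t = ζM M' := ht
    change (τ.modAll M).red t = ζM M
    rw [← τ.red_modAll M M' h t, ht']
    exact red_cyclotome_apply ζ M M' h
  have hdir : Directed (· ⊇ ·) F := fun M₁ M₂ =>
    ⟨M₁ * M₂, hsub M₁ (M₁ * M₂) (by rw [PNat.mul_coe]; exact dvd_mul_right _ _),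
      hsub M₂ (M₁ * M₂) (by rw [PNat.mul_coe]; exact dvd_mul_left _ _)⟩
  have hne : ∀ M, (F M).Nonempty := fun M => (τ.modAll M).red_surjective (ζM M)
  have hclosed : ∀ M, IsClosed (F M) := fun M =>
    (isClosed_discrete {ζM M}).preimage (τ.modAll M).continuous_red
  have hcpt : ∀ M, IsCompact (F M) := fun M => (hclosed M).isCompact
  obtain ⟨t, ht⟩ := IsCompact.nonempty_iInter_of_directed_nonempty_isCompact_isClosed F hdir hne hcpt hclosed
  exact ⟨t, fun M => Set.mem_iInter.1 ht M⟩

/-- Conjugation-equivariance of the reductions, read on `Π^tp_X̲̲ ⊆ Π^tp_X` with its action on `ℚ̄_pˣ` through `ε`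
(`unitsAction`): `red_M(φ(g) t φ(g)⁻¹) = g • red_M(t)` in `ℚ̄_pˣ` (`red_conj` of the tower).
[cite: MochizukiEtTh2009, Def 2.13 p.46] -/
theorem coe_modAll_red_conjNormal (τ : D.CyclotomeTower l Es) (g : Pi C) (t : D.lDeltaTheta l) (M : ℕ+) :
    (((τ.modAll M).red (MulAut.conjNormal (phi C g) t) : MuN p M) : (PadicAlgCl p)ˣ) =
      g • (((τ.modAll M).red t : MuN p M) : (PadicAlgCl p)ˣ) := by
  have hconj : MulAut.conjNormal (phi C g) t =
      ⟨D.toTheta (g : D.PiTemp) * t * (D.toTheta (g : D.PiTemp))⁻¹, (D.lDeltaTheta_normal l).conj_mem _ t.2 _⟩ :=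
    Subtype.ext (MulAut.conjNormal_apply _ _)
  rw [hconj, (τ.modAll M).red_conj]
  apply Units.ext
  rw [galMuN_apply_coe, units_coe_smul]
  rfl

/-! ### The change of coefficient cyclotome `Λ(ℚ̄_pˣ) ⥲ l·Δ_Θ` from the tower -/

/-- **The cyclotomic rigidity datum of [IUTchII] Cor. 1.11 (a),(b) / "`Δ_Θ ≅ Ẑ(1)`" at the model, CONSTRUCTED
from abc-iut-L2's cyclotome tower**: given the origin guard `hO`, compactness of `Δ_Θ`, and
`τ : D.CyclotomeTower l Es`, there is a BIJECTIVE change of coefficient cyclotome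
`c : CyclotomeCoefficients (phi C) (l·Δ_Θ) ℚ̄_pˣ` (a continuous `Π^tp_X̲̲`-equivariant isomorphism
`Λ(ℚ̄_pˣ) = Ẑ(1) ⥲ l·Δ_Θ`) inverse to `t ↦ (red_M t)_M`: `red_M (c ζ) = ζ_M` for every `M ≥ 1`.  Continuity of `c`:
`t ↦ (red_M t)_M` is a continuous bijection from the compact `l·Δ_Θ` onto the Hausdorff `Λ(ℚ̄_pˣ)`, hence a
homeomorphism.  This is the datum every `…_of_coeff` theorem of `EtaleThetaDataOfSettingGaloisUnits.lean` takes.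
[cite: Mochizuki2012, Cor 1.12 p.56] -/
theorem exists_cyclotomeCoefficients_of_cyclotomeTower (hO : D.IsEtThOrigin)
    (hΔ : IsCompact (D.DeltaTheta : Set D.GtpTheta)) (τ : D.CyclotomeTower l Es) :
    ∃ c : CyclotomeCoefficients (phi C) (D.lDeltaTheta l) (PadicAlgCl p)ˣ,
      Function.Bijective c.hom ∧
        ∀ (ζ : cyclotome (PadicAlgCl p)ˣ) (M : ℕ+),
          (((τ.modAll M).red (c.hom ζ) : MuN p M) : (PadicAlgCl p)ˣ) = (ζ : ℕ+ → (PadicAlgCl p)ˣ) M := by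
  haveI := compactSpace_lDeltaTheta (l := l) hΔ
  -- the level map `j : l·Δ_Θ → Λ(ℚ̄_pˣ)`, `t ↦ (red_M t)_M`
  let j : D.lDeltaTheta l →* cyclotome (PadicAlgCl p)ˣ :=
    { toFun := fun t => ⟨fun M => (((τ.modAll M).red t : MuN p M) : (PadicAlgCl p)ˣ),
        modAll_red_mem_cyclotome τ t⟩
      map_one' := Subtype.ext (funext fun M => by simp)
      map_mul' := fun s t => Subtype.ext (funext fun M => by simp) }
  have hj_apply : ∀ (t : D.lDeltaTheta l) (M : ℕ+),
      ((j t : cyclotome (PadicAlgCl p)ˣ) : ℕ+ → (PadicAlgCl p)ˣ) M =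
        (((τ.modAll M).red t : MuN p M) : (PadicAlgCl p)ˣ) := fun _ _ => rfl
  -- injective: joint injectivity of the tower
  have hj_inj : Function.Injective j := by
    intro s t hst
    refine eq_of_forall_modAll_red_eq hO τ fun M => Subtype.ext ?_
    rw [← hj_apply s M, ← hj_apply t M, hst]
  -- surjective: Cantor intersection in the compact `l·Δ_Θ`
  have hj_surj : Function.Surjective j := by
    intro ζ
    obtain ⟨t, ht⟩ := exists_forall_modAll_red_eq hΔ τ ζ
    exact ⟨t, Subtype.ext (funext fun M => by rw [hj_apply, ht M])⟩
  have hj_bij : Function.Bijective j := ⟨hj_inj, hj_surj⟩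
  -- continuous: each level is continuous into the discrete `μ_M ⊆ ℚ̄_pˣ`
  have hj_cont : Continuous j := by
    refine Continuous.subtype_mk (continuous_pi fun M => ?_) _
    exact continuous_subtype_val.comp (τ.modAll M).continuous_red
  -- hence a homeomorphism onto the Hausdorff cyclotome; its inverse is continuous
  let e : D.lDeltaTheta l ≃* cyclotome (PadicAlgCl p)ˣ := MulEquiv.ofBijective j hj_bij
  have he_cont : Continuous e.symm :=
    (Continuous.homeoOfEquivCompactToT2 (f := Equiv.ofBijective j hj_bij) hj_cont).symm.continuous
  have he_apply : ∀ t, e t = j t := fun _ => rfl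
  -- equivariance of `j`
  have hj_smul : ∀ (g : Pi C) (t : D.lDeltaTheta l), j (MulAut.conjNormal (phi C g) t) = g • j t := by
    intro g t
    refine Subtype.ext (funext fun M => ?_)
    rw [hj_apply, cyclotome.smul_apply, hj_apply]
    exact coe_modAll_red_conjNormal C τ g t M
  refine ⟨⟨e.symm.toMonoidHom, he_cont, fun g ζ => ?_⟩, e.symm.bijective, fun ζ M => ?_⟩
  · -- `c (g • ζ) = φ(g) c(ζ) φ(g)⁻¹`: apply the injective `e` and use equivariance of `j`
    change e.symm (g • ζ) = MulAut.conjNormal (phi C g) (e.symm ζ)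
    apply e.injective
    rw [e.apply_symm_apply, he_apply, hj_smul, ← he_apply, e.apply_symm_apply]
  · -- the level formula: `red_M (c ζ) = ζ_M`
    change (((τ.modAll M).red (e.symm ζ) : MuN p M) : (PadicAlgCl p)ˣ) = _
    rw [← hj_apply, ← he_apply, e.apply_symm_apply]

/-! ### Cor. 1.12 (c) and Prop. 3.1 (ii) at the model, modulo the tower (no coefficient binder) -/

/-- **Cor. 1.12 (c), second inclusion, at the model**: the restriction
`lim_K H¹(K, l·Δ_Θ) → lim_K H¹(Π^tp_Ÿ̲̲ ⊓ K, l·Δ_Θ)` (abc-iut-L6-t1's interface field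
`ThetaEvaluation.inclHd_injective`) is INJECTIVE, given the origin guard and a cyclotome tower — abc-iut-w4-d041's
`h1LimRestrict_injective_of_forall_fixed_eq_one` with its «no invariants» binder discharged by
`hfix_of_cyclotomeTower` (no compactness needed). [claim: Mochizuki2012, status: disputed]
(IUTchII Cor 1.12 (c), kurims p.56 "natural inclusion") -/
theorem h1LimRestrict_PiYdd_injective_of_cyclotomeTower (hC : D.Compat) (hO : D.IsEtThOrigin)
    (τ : D.CyclotomeTower l Es) :
    Function.Injective (h1LimRestrict (phi C) (D.lDeltaTheta l) (le_top : PiYdd C ≤ ⊤) ⊥) := by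
  haveI := piYdd_normal C hC
  exact h1LimRestrict_injective_of_forall_fixed_eq_one (phi C) (D.lDeltaTheta l) (le_top : PiYdd C ≤ ⊤) ⊥
    fun K hK _ _ a ha => hfix_of_cyclotomeTower C hO τ K hK a ha

/-- **Cor. 1.12 (c), first inclusion "`M^×_TM(Π) ↪ lim_J H¹(J, (l·Δ_Θ)(Π))`", at the model**: given the origin
guard, compactness of `Δ_Θ` and a cyclotome tower, there is an INJECTIVE homomorphism
`κ : ℚ̄_pˣ → lim_K H¹(K, l·Δ_Θ)` (`K` over the finite-index open subgroups of `Π^tp_X̲̲`; `M^×_TM = 𝒪^× ⊆ ℚ̄_pˣ`),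
EQUIVARIANT for the Galois action through `ε` on `ℚ̄_pˣ` and the conjugation action `h1LimConjMulAut` on the limit
— namely the Kummer map `h1LimKummer` of `CohomologyLimitKummer.lean` along the change of coefficient cyclotome of
`exists_cyclotomeCoefficients_of_cyclotomeTower`. [claim: Mochizuki2012, status: disputed]
(IUTchII Cor 1.12 (c), kurims p.56) -/
theorem exists_h1LimKummer_top_of_cyclotomeTower (hO : D.IsEtThOrigin)
    (hΔ : IsCompact (D.DeltaTheta : Set D.GtpTheta)) (τ : D.CyclotomeTower l Es) :
    ∃ κ : (PadicAlgCl p)ˣ →* Multiplicative (h1Lim (phi C) (D.lDeltaTheta l) (⊤ : Subgroup (Pi C)) ⊥),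
      Function.Injective κ ∧
        ∀ (g : Pi C) (u : (PadicAlgCl p)ˣ),
          κ (g • u) = CohomologySystemOfContH1.h1LimConjMulAut (phi C) (D.lDeltaTheta l) ⊤ g (κ u) := by
  obtain ⟨c, hc, -⟩ := exists_cyclotomeCoefficients_of_cyclotomeTower C hO hΔ τ
  exact ⟨CohomologySystemOfContH1.h1LimKummer (phi C) (D.lDeltaTheta l) ⊤ c (isOpen_stabilizer_units C)
      (finiteIndex_stabilizer_units C),
    h1LimKummer_injective_of_coeff C (phi C) (D.lDeltaTheta l) c ⊤ hc,
    fun g u => CohomologySystemOfContH1.h1LimKummer_smul (phi C) (D.lDeltaTheta l) ⊤ c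
      (isOpen_stabilizer_units C) (finiteIndex_stabilizer_units C) g u⟩

/-- **Prop. 3.1 (ii) "`Ψ_cns(M^Θ_*) := M_TM(M^Θ_*) ⊆ lim_J H¹(Π_Ÿ(M^Θ_*)|_J, Π_μ(M^Θ_*))` … equipped with a natural
conjugation action by `Π_X(M^Θ_*)`", at the model** (coefficients `l·Δ_Θ`; `Π_Ÿ(Π) = Π^tp_Ÿ̲̲`): given the
origin guard, compactness of `Δ_Θ` and a cyclotome tower, there is an INJECTIVE `Π^tp_X̲̲`-EQUIVARIANT homomorphism
`κ : ℚ̄_pˣ → lim_K H¹(Π^tp_Ÿ̲̲ ⊓ K, l·Δ_Θ)` under which the image of every Galois-stable submonoid of `ℚ̄_pˣ` (the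
constants `O^▷ = 𝒪_k̄^▷`, the units `𝒪_k̄^×`) is STABLE under the conjugation action — the Kummer map along the
change of coefficient cyclotome of `exists_cyclotomeCoefficients_of_cyclotomeTower`.
[claim: Mochizuki2012, status: disputed] (IUTchII §3 Prop 3.1 (ii), kurims p.88) -/
theorem exists_h1LimKummer_PiYdd_of_cyclotomeTower (hC : D.Compat) (hO : D.IsEtThOrigin)
    (hΔ : IsCompact (D.DeltaTheta : Set D.GtpTheta)) (τ : D.CyclotomeTower l Es) :
    haveI := piYdd_normal C hC
    ∃ κ : (PadicAlgCl p)ˣ →* Multiplicative (h1Lim (phi C) (D.lDeltaTheta l) (PiYdd C) ⊥),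
      Function.Injective κ ∧
        (∀ (g : Pi C) (u : (PadicAlgCl p)ˣ),
          κ (g • u) = CohomologySystemOfContH1.h1LimConjMulAut (phi C) (D.lDeltaTheta l) (PiYdd C) g (κ u)) ∧
        ∀ (O : Submonoid (PadicAlgCl p)ˣ),
          (∀ (σ : GQp p) (u : (PadicAlgCl p)ˣ), u ∈ O → Units.map (σ : PadicAlgCl p →* PadicAlgCl p) u ∈ O) →
            ∀ (g : Pi C) (y : Multiplicative (h1Lim (phi C) (D.lDeltaTheta l) (PiYdd C) ⊥)), y ∈ O.map κ →
              CohomologySystemOfContH1.h1LimConjMulAut (phi C) (D.lDeltaTheta l) (PiYdd C) g y ∈ O.map κ := by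
  haveI := piYdd_normal C hC
  obtain ⟨c, hc, -⟩ := exists_cyclotomeCoefficients_of_cyclotomeTower C hO hΔ τ
  exact ⟨CohomologySystemOfContH1.h1LimKummer (phi C) (D.lDeltaTheta l) (PiYdd C) c (isOpen_stabilizer_units C)
      (finiteIndex_stabilizer_units C),
    h1LimKummer_injective_of_coeff C (phi C) (D.lDeltaTheta l) c (PiYdd C) hc,
    fun g u => CohomologySystemOfContH1.h1LimKummer_smul (phi C) (D.lDeltaTheta l) (PiYdd C) c
      (isOpen_stabilizer_units C) (finiteIndex_stabilizer_units C) g u,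
    fun O hO' g y hy => map_h1LimKummer_PiYdd_stable C (phi C) (D.lDeltaTheta l) c hC O hO' g y hy⟩

end EtaleThetaDataOfSetting

end Literature.IUT.HodgeArakelov

end
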